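import Mathlib

/-!
# `RisoCurves` (stmt-ResolutionOfSingularities-18550), Part A.1: initial forms of algebraic relations
# read in Hahn series, and coordinates of a plane in `kⁿ`

Route `ResolutionOfSingularities/RisoStrata`, support item `RisoCurves`. Elementary lemmas used by
`RisoStrataRisoCurvesRtd.lean` (the vanishing of the typed riso-triviality dimension `≥ 2` in
transcendence degree one):

* `le_orderTop_mul_and_coeff_mul`, `…_pow_…`, `…_prod_…`, `le_orderTop_monomial_and_coeff` —
  for Hahn series `u_l ∈ k⟦t^ℚ⟧` of order `≥ γ`, a monomial `u^d` has order `≥ |d| γ` and its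
  coefficient there is the monomial in the `γ`-coefficients;
* `coeff_aeval_eq_eval_homogeneousComponent` — hence for `P ∈ k[X_σ]` all of whose monomials have
  degree `≥ d₀`, the coefficient of `t^{d₀ γ}` in `P(u)` is the value of the degree-`d₀`
  homogeneous component of `P` at the vector of `γ`-coefficients (`γ > 0`);
* `exists_two_coords` — a subspace `W ≤ kⁿ` of dimension `≥ 2` projects onto `k²` along two
  coordinates `i₁ ≠ i₂`.

No definitions, no named facts.
-/

noncomputable section

set_option linter.dupNamespace false -- mandated namespace of this single-conjunct summit

namespace Summit.ResolutionOfSingularities.ResolutionOfSingularities.Theorems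

open HahnSeries

/-! ## Leading coefficients of products of Hahn series -/

section Hahn

variable {k : Type*} [Field k]

/-- If `x` has order `≥ α` and `y` has order `≥ β` then `x y` has order `≥ α + β` and its
coefficient at `α + β` is the product of the coefficients at `α` and `β`. [folklore] -/
theorem le_orderTop_mul_and_coeff_mul {x y : HahnSeries ℚ k} {α β : ℚ}
    (hx : (α : WithTop ℚ) ≤ x.orderTop) (hy : (β : WithTop ℚ) ≤ y.orderTop) :
    ((α + β : ℚ) : WithTop ℚ) ≤ (x * y).orderTop ∧ (x * y).coeff (α + β) = x.coeff α * y.coeff β := by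
  constructor
  · calc ((α + β : ℚ) : WithTop ℚ) = (α : WithTop ℚ) + (β : WithTop ℚ) := WithTop.coe_add α β
      _ ≤ x.orderTop + y.orderTop := add_le_add hx hy
      _ ≤ (x * y).orderTop := orderTop_add_le_mul
  · classical
    rw [coeff_mul]
    have hα : ∀ i ∈ x.support, α ≤ i := fun i hi =>
      WithTop.coe_le_coe.mp (hx.trans (orderTop_le_of_coeff_ne_zero (by simpa using hi)))
    have hβ : ∀ j ∈ y.support, β ≤ j := fun j hj =>
      WithTop.coe_le_coe.mp (hy.trans (orderTop_le_of_coeff_ne_zero (by simpa using hj)))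
    rw [Finset.sum_eq_single (α, β)]
    · rintro ⟨i, j⟩ hij hne
      exfalso
      rw [Finset.mem_antidiagonal] at hij
      obtain ⟨hi, hj, hsum⟩ := hij
      have hi' := hα i hi
      have hj' := hβ j hj
      have hi2 : i = α := by
        by_contra h
        have : α < i := lt_of_le_of_ne hi' (Ne.symm h)
        have : α + β < i + j := add_lt_add_of_lt_of_le this hj'
        exact (lt_irrefl _ (hsum ▸ this))
      have hj2 : j = β := by
        have : i + j = α + β := hsum
        rw [hi2] at this
        exact add_left_cancel this
      exact hne (Prod.ext hi2 hj2)
    · intro h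
      rw [Finset.mem_antidiagonal] at h
      simp only [mem_support, ne_eq, not_and] at h
      by_cases hxa : x.coeff α = 0
      · rw [hxa, zero_mul]
      · by_cases hyb : y.coeff β = 0
        · rw [hyb, mul_zero]
        · exact absurd trivial (h hxa hyb)

/-- Powers: if `x` has order `≥ γ` then `xⁿ` has order `≥ n γ` and coefficient `(x_γ)ⁿ` there.
[folklore] -/
theorem le_orderTop_pow_and_coeff_pow {x : HahnSeries ℚ k} {γ : ℚ}
    (hx : (γ : WithTop ℚ) ≤ x.orderTop) (n : ℕ) :
    ((n • γ : ℚ) : WithTop ℚ) ≤ (x ^ n).orderTop ∧ (x ^ n).coeff (n • γ) = (x.coeff γ) ^ n := by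
  induction n with
  | zero =>
    simp only [zero_smul, pow_zero, WithTop.coe_zero]
    exact ⟨by simp, by simp⟩
  | succ n ih =>
    obtain ⟨h1, h2⟩ := le_orderTop_mul_and_coeff_mul ih.1 hx
    rw [succ_nsmul, pow_succ]
    exact ⟨h1, by rw [h2, ih.2, pow_succ]⟩

/-- Finite products: orders add and leading coefficients multiply. [folklore] -/
theorem le_orderTop_prod_and_coeff_prod {ι : Type*} (s : Finset ι) (z : ι → HahnSeries ℚ k)
    (α : ι → ℚ) (h : ∀ i ∈ s, (α i : WithTop ℚ) ≤ (z i).orderTop) :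
    ((∑ i ∈ s, α i : ℚ) : WithTop ℚ) ≤ (∏ i ∈ s, z i).orderTop ∧
      (∏ i ∈ s, z i).coeff (∑ i ∈ s, α i) = ∏ i ∈ s, (z i).coeff (α i) := by
  classical
  induction s using Finset.induction_on with
  | empty =>
    simp only [Finset.sum_empty, Finset.prod_empty, WithTop.coe_zero]
    exact ⟨by simp, by simp⟩
  | insert a s ha ih =>
    have ih' := ih (fun i hi => h i (Finset.mem_insert_of_mem hi))
    have hha := h a (Finset.mem_insert_self a s)
    obtain ⟨h1, h2⟩ := le_orderTop_mul_and_coeff_mul hha ih'.1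
    rw [Finset.sum_insert ha, Finset.prod_insert ha, Finset.prod_insert ha]
    exact ⟨h1, by rw [h2, ih'.2]⟩

/-- Monomials: for `u_l` of order `≥ γ`, `∏ u_l^{d_l}` has order `≥ |d| γ` and coefficient
`∏ (u_l)_γ^{d_l}` there. [folklore] -/
theorem le_orderTop_monomial_and_coeff {σ : Type*} (d : σ →₀ ℕ) (u : σ → HahnSeries ℚ k)
    {γ : ℚ} (hu : ∀ l, (γ : WithTop ℚ) ≤ (u l).orderTop) :
    ((d.degree • γ : ℚ) : WithTop ℚ) ≤ (d.prod fun l e => u l ^ e).orderTop ∧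
      (d.prod fun l e => u l ^ e).coeff (d.degree • γ) = d.prod fun l e => ((u l).coeff γ) ^ e := by
  have key := le_orderTop_prod_and_coeff_prod d.support (fun l => u l ^ d l) (fun l => d l • γ)
    (fun l _ => (le_orderTop_pow_and_coeff_pow (hu l) (d l)).1)
  have hsum : (∑ l ∈ d.support, d l • γ) = d.degree • γ := by
    rw [Finsupp.degree_apply, Finset.sum_smul]
  rw [hsum] at key
  refine ⟨key.1, ?_⟩
  rw [Finsupp.prod, key.2, Finsupp.prod]
  refine Finset.prod_congr rfl fun l _ => ?_
  exact (le_orderTop_pow_and_coeff_pow (hu l) (d l)).2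

/-- **Reading an algebraic relation at its initial degree.** If every `u_l` has order `≥ γ > 0`
and every monomial of `P` has degree `≥ d₀`, then the coefficient of `t^{d₀ γ}` in `P(u)` is the
value of the degree-`d₀` homogeneous component of `P` at the vector of `γ`-coefficients of `u`.
[folklore] -/
theorem coeff_aeval_eq_eval_homogeneousComponent {σ : Type*} (P : MvPolynomial σ k)
    (u : σ → HahnSeries ℚ k) {γ : ℚ} (hγ : 0 < γ) (hu : ∀ l, (γ : WithTop ℚ) ≤ (u l).orderTop)
    (d₀ : ℕ) (hd₀ : ∀ d ∈ P.support, d₀ ≤ d.degree) :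
    (MvPolynomial.aeval u P).coeff (d₀ • γ) =
      MvPolynomial.eval (fun l => (u l).coeff γ) (MvPolynomial.homogeneousComponent d₀ P) := by
  classical
  conv_lhs => rw [P.as_sum]
  rw [map_sum, coeff_sum, MvPolynomial.homogeneousComponent_apply, map_sum, Finset.sum_filter]
  refine Finset.sum_congr rfl fun d hd => ?_
  rw [MvPolynomial.aeval_monomial, HahnSeries.algebraMap_apply', PowerSeries.algebraMap_eq,
    HahnSeries.ofPowerSeries_C, C_mul_eq_smul, coeff_smul, smul_eq_mul]
  obtain ⟨hord, hcoeff⟩ := le_orderTop_monomial_and_coeff d u hu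
  split_ifs with hdeg
  · rw [MvPolynomial.eval_monomial, ← hdeg, hcoeff]
  · have hlt : d₀ < d.degree := lt_of_le_of_ne (hd₀ d hd) (Ne.symm hdeg)
    have : ((d₀ • γ : ℚ) : WithTop ℚ) < (d.prod fun l e => u l ^ e).orderTop := by
      refine lt_of_lt_of_le ?_ hord
      exact WithTop.coe_lt_coe.mpr (nsmul_lt_nsmul_left hγ hlt)
    rw [coeff_eq_zero_of_lt_orderTop this, mul_zero]

end Hahn

/-! ## Two coordinates of a plane in `kⁿ` take arbitrary values -/

section Coords

variable {k : Type*} [Field k]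

/-- A subspace `W ≤ kⁿ` of dimension `≥ 2` has two coordinates `i₁ ≠ i₂` on which it projects
ONTO `k²`. [folklore] -/
theorem exists_two_coords {n : ℕ} (W : Submodule k (Fin n → k)) (hW : 2 ≤ Module.finrank k W) :
    ∃ i₁ i₂ : Fin n, i₁ ≠ i₂ ∧ ∀ a b : k, ∃ u ∈ W, u i₁ = a ∧ u i₂ = b := by
  have h1 : 1 < Module.finrank k W := hW
  obtain ⟨x, hx⟩ : ∃ x : W, x ≠ 0 := by
    have : 0 < Module.finrank k W := by omega
    rw [Module.finrank_pos_iff_exists_ne_zero] at this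
    exact this
  obtain ⟨y, hxy⟩ := exists_linearIndependent_pair_of_one_lt_finrank h1 hx
  set X : Fin n → k := (x : Fin n → k) with hX
  set Y : Fin n → k := (y : Fin n → k) with hY
  have hX0 : X ≠ 0 := fun h => hx (Subtype.ext h)
  obtain ⟨i₁, hi₁⟩ : ∃ i, X i ≠ 0 := Function.ne_iff.mp hX0
  set c : k := Y i₁ / X i₁ with hc
  set Y' : Fin n → k := Y - c • X with hY'
  have hY'i₁ : Y' i₁ = 0 := by
    simp only [hY', Pi.sub_apply, Pi.smul_apply, smul_eq_mul, hc]
    field_simp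
    ring
  have hY'0 : Y' ≠ 0 := by
    intro h0
    have hrel : c • x + (-1 : k) • y = 0 := by
      apply Subtype.ext
      change c • X + (-1 : k) • Y = 0
      have : Y = c • X := by
        have := sub_eq_zero.mp (show Y - c • X = 0 from h0)
        exact this
      rw [this]; simp
    have := (LinearIndependent.pair_iff.mp hxy c (-1) hrel).2
    norm_num at this
  obtain ⟨i₂, hi₂⟩ : ∃ i, Y' i ≠ 0 := Function.ne_iff.mp hY'0
  have hne : i₁ ≠ i₂ := by
    rintro rfl
    exact hi₂ hY'i₁
  have hXW : X ∈ W := x.2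
  have hYW : Y ∈ W := y.2
  have hY'W : Y' ∈ W := W.sub_mem hYW (W.smul_mem c hXW)
  refine ⟨i₁, i₂, hne, fun a b => ?_⟩
  set α : k := a / X i₁ with hα
  set β : k := (b - α * X i₂) / Y' i₂ with hβ
  refine ⟨α • X + β • Y', W.add_mem (W.smul_mem α hXW) (W.smul_mem β hY'W), ?_, ?_⟩
  · simp only [Pi.add_apply, Pi.smul_apply, smul_eq_mul, hY'i₁, mul_zero, add_zero, hα]
    field_simp
  · simp only [Pi.add_apply, Pi.smul_apply, smul_eq_mul, hβ]
    field_simp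
    ring

end Coords

end Summit.ResolutionOfSingularities.ResolutionOfSingularities.Theorems
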